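import Summits.Parity.GeneralizedHardyLittlewood.Theorems.BeyondDiagonalBeatsQuarter.OffDiagPoissonTwistedLattice
import Summits.Parity.GeneralizedHardyLittlewood.Theorems.BeyondDiagonalBeatsQuarter.OffDiagDyadic
import Summits.Parity.GeneralizedHardyLittlewood.Theorems.BeyondDiagonalBeatsQuarter.OffDiagWeightSmooth
import HarnessLib

/-!
# Route `PrimeLevelFamEdge`, crux K_B (stmt-Parity-20343), line `diagonal_kernel_split` rev 4,
# plan Ω, sub-line **Ω-d5 — Poisson summation APPLIED to a Kloosterman layer of `offDiag`: the dual
# (frequency) side, box by box, with the zero frequency ABSENT and the dual congruence `h₁h₂ ≡ αβ (mod qr)`**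

Assembly of Ω-d1 (`OffDiagPoissonTwisted*`: twisted two-variable Poisson summation for a smooth compactly
supported weight, `tsum_nat_prod_mul_stdAddChar_eq_of_contDiff`), Ω-d2 (`OffDiagZeroFrequency`: the complete
sums `Σ_{x mod c} S(αx₁,βx₂;c)e_c(h·x) = c²·#{u : αu = −h₁, βū = −h₂}`), Ω-d4 (`OffDiagDyadic`: the smooth dyadic
partition and the box weights; `OffDiagWeightSmooth`: the factorisation
`w_q(d₁k₁,d₂k₂)·petKloostermanTerm q (αk₁)(βk₂) r = g(k)·S(α·k₁, β·k₂; qr)` with `g ∈ C^∞((0,∞)²)`).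
For a layer `(d₁, d₂, r)` of `PeterssonSplit.offDiag q l m` (`α = l/d₁`, `β = m/d₂`, modulus `c = qr`;
GATE G2 §(a) rows a5–a6):

* objects (definitions, reviewed): `layerWeightR q d₁ d₂ α β r` (the real weight `g`), `boxWeight … i`
  (`Φ_i(y₁,y₂) = θ(y₁/2^{i₁})θ(y₂/2^{i₂})·g(y₁,y₂)`, curried for the Poisson API), `dualCount c α β h₁ h₂`
  (`N_c = #{u ∈ (ℤ/c)ˣ : αu + h₁ = 0 ∧ βū + h₂ = 0}`);
* `contDiff_uncurry_boxWeight`, `hasCompactSupport_uncurry_boxWeight`, `boxWeight_ne_zero_pos` — `Φ_i` is a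
  Poisson datum living on the open quadrant;
* **`tsum_box_eq_tsum_dual`** — THE BOX IDENTITY:
  `Σ_{k ∈ ℕ²} θ(k₁/2^{i₁})θ(k₂/2^{i₂})·w_q(d₁k₁,d₂k₂)·petKloostermanTerm q (αk₁)(βk₂) r
     = Σ_{(h₁,h₂) ∈ ℤ²} Φ̂_i(h₁/(qr), h₂/(qr)) · N_{qr}(α,β;h₁,h₂)` (the `(qr)^{−2}` of Poisson cancels the `(qr)²` of
  the complete sum), both sides absolutely convergent;
* `dualCount_zero_left` (`α ≢ 0 ⇒ N(0,h₂) = 0`: the ZERO FREQUENCY IS ABSENT — at prime level for every layer,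
  `dualCount_primeLevel_zero_left`), `dualCount_eq_zero_of_ne` (only `h₁h₂ ≡ αβ` survive), `dualCount_le_one`;
* **`tsum_layer_eq_tsum_boxes_dual`** — THE LAYER IDENTITY: if the layer summand is absolutely summable,
  `Σ_{k ∈ ℕ²} w_q(d₁k₁,d₂k₂)·petKloostermanTerm q (αk₁)(βk₂) r = Σ_{i ∈ ℕ²} Σ_{h ∈ ℤ²} Φ̂_i(h/(qr))·N_{qr}(α,β;h)`.

Exact identities; no estimate of any dual term (that is Ω-e/Ω-a7/Ω-f/Ω-g). Helper; closes nothing; standard axioms.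
«The programme SEARCHES and TYPES; no claim about Landau–Siegel zeros, Theorems 1–2 of arXiv:2211.02515 or
a repaired Margin232 until a kernel theorem says so.»
-/

noncomputable section

open Finset Set
open scoped Real FourierTransform ContDiff

namespace Summit.Parity.GeneralizedHardyLittlewood.Theorems.BeyondDiagonalBeatsQuarter.OffDiag

open Literature.NumberTheory.LFunctions Literature.NumberTheory.LFunctions.KMV2000
open Literature.NumberTheory.LFunctions.KowalskiMichel2000 (petKloostermanTerm)
open Literature.Analysis.FunctionSpaces (besselJ)
open Literature.Analysis.Calculus.WhitneyConvex (dyadicBump)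
open Literature.NumberTheory.Sieve.FriedlanderIwaniecPrimes (fourier2)
open PeterssonSplit (afeWeight)
open OffDiagPoissonTwisted (tsum_nat_prod_mul_stdAddChar_eq_of_contDiff)

/-! ### The objects of the dual side -/

/-- **The real weight of the layer `(d₁,d₂,r)`** at frequency parameters `α, β`:
`g(y₁,y₂) = ((d₁y₁)(d₂y₂))^{−1/2} W((d₁y₁)(d₂y₂)/q̂²) · r⁻¹ · J₁(4π√(αy₁·βy₂)/(qr))` (`W = KMV2000.cutoffW`,
`J₁ = besselJ 1`). [cite: KowalskiMichelVanderKam2000, (21)–(23) p. 12; KowalskiMichel2000, §2.4.2 p. 312 — derivation] -/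
def layerWeightR (q d₁ d₂ α β r : ℕ) (y : ℝ × ℝ) : ℝ :=
  ((d₁ : ℝ) * y.1 * ((d₂ : ℝ) * y.2)) ^ (-(1 / 2 : ℝ)) *
      cutoffW ((d₁ : ℝ) * y.1 * ((d₂ : ℝ) * y.2) / qhat q ^ 2) * (r : ℝ)⁻¹ *
    besselJ 1 (4 * π * Real.sqrt ((α : ℝ) * y.1 * ((β : ℝ) * y.2)) / ((q : ℝ) * r))

/-- **The box weight `Φ_i`** of dyadic box `i = (i₁,i₂)`: `Φ_i(y₁,y₂) = θ(y₁/2^{i₁})θ(y₂/2^{i₂})·g(y₁,y₂)`, complex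
valued and curried (the datum of the twisted Poisson formula). [cite: KowalskiMichelVanderKam2000, (21)–(23) p. 12 — derivation] -/
def boxWeight (q d₁ d₂ α β r : ℕ) (i : ℕ × ℕ) (y₁ y₂ : ℝ) : ℂ :=
  ((dyadicBump (y₁ / 2 ^ i.1) * dyadicBump (y₂ / 2 ^ i.2) : ℝ) : ℂ) *
    ((layerWeightR q d₁ d₂ α β r (y₁, y₂) : ℝ) : ℂ)

/-- **The dual count** `N_c(α,β;h₁,h₂) = #{u ∈ (ℤ/c)ˣ : αu + h₁ = 0 ∧ βū + h₂ = 0}` (the multiplicity of the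
frequency pair `(h₁,h₂)` after Poisson summation modulo `c`; `OffDiag.sum_sum_kloostermanSum_mul_stdAddChar`).
[cite: KowalskiMichelVanderKam2000, Lemma 3.3 p. 9 — derivation] -/
def dualCount (c : ℕ) [NeZero c] (α β h₁ h₂ : ZMod c) : ℕ :=
  ((univ : Finset (ZMod c)ˣ).filter (fun u : (ZMod c)ˣ ↦
    α * (u : ZMod c) + h₁ = 0 ∧ β * ((u⁻¹ : (ZMod c)ˣ) : ZMod c) + h₂ = 0)).card

/-! ### The box weight is a Poisson datum on the open quadrant -/

section BoxWeight

variable {q d₁ d₂ α β r : ℕ}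

/-- Uncurrying the box weight gives the `θθ·g` shape of `OffDiagDyadic`. [folklore] -/
theorem uncurry_boxWeight (i : ℕ × ℕ) :
    Function.uncurry (boxWeight q d₁ d₂ α β r i) = fun y : ℝ × ℝ ↦
      ((dyadicBump (y.1 / 2 ^ i.1) * dyadicBump (y.2 / 2 ^ i.2) : ℝ) : ℂ) *
        ((layerWeightR q d₁ d₂ α β r y : ℝ) : ℂ) := by
  funext y
  rfl

/-- The complex layer weight is `C^∞` on the open quadrant (for `q, d₁, d₂, α, β ≥ 1`).
[cite: KowalskiMichelVanderKam2000, (21)–(23) p. 12 — derivation] -/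
theorem contDiffOn_layerWeightR_ofReal [NeZero q] (hd₁ : 1 ≤ d₁) (hd₂ : 1 ≤ d₂) (hα : 1 ≤ α) (hβ : 1 ≤ β) :
    ContDiffOn ℝ ∞ (fun y : ℝ × ℝ ↦ ((layerWeightR q d₁ d₂ α β r y : ℝ) : ℂ)) (Ioi (0 : ℝ) ×ˢ Ioi (0 : ℝ)) :=
  contDiffOn_layerWeight (by exact_mod_cast hd₁) (by exact_mod_cast hd₂) (qhat_pos_of_neZero q)
    (by exact_mod_cast hα) (by exact_mod_cast hβ) _ _

/-- **`Φ_i` is smooth on `ℝ²`.** [folklore] -/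
theorem contDiff_uncurry_boxWeight [NeZero q] (hd₁ : 1 ≤ d₁) (hd₂ : 1 ≤ d₂) (hα : 1 ≤ α) (hβ : 1 ≤ β)
    (i : ℕ × ℕ) : ContDiff ℝ ∞ (Function.uncurry (boxWeight q d₁ d₂ α β r i)) := by
  rw [uncurry_boxWeight]
  exact contDiff_dyadicBox_mul (by positivity) (by positivity) (contDiffOn_layerWeightR_ofReal hd₁ hd₂ hα hβ)

/-- **`Φ_i` has compact support** (inside `[2^{i₁}/2, 2^{i₁+1}] × [2^{i₂}/2, 2^{i₂+1}]`). [folklore] -/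
theorem hasCompactSupport_uncurry_boxWeight (i : ℕ × ℕ) :
    HasCompactSupport (Function.uncurry (boxWeight q d₁ d₂ α β r i)) := by
  rw [uncurry_boxWeight]
  exact hasCompactSupport_dyadicBox_mul (by positivity) (by positivity) _

/-- `Φ_i` lives on the open quadrant: `Φ_i(t₁,t₂) ≠ 0 ⇒ t₁, t₂ > 0`. [folklore] -/
theorem boxWeight_ne_zero_pos (i : ℕ × ℕ) (t₁ t₂ : ℝ) (h : boxWeight q d₁ d₂ α β r i t₁ t₂ ≠ 0) :
    0 < t₁ ∧ 0 < t₂ := by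
  have hmem := support_dyadicBox_mul_subset (K₁ := (2 : ℝ) ^ i.1) (K₂ := (2 : ℝ) ^ i.2) (by positivity)
    (by positivity) (fun y : ℝ × ℝ ↦ ((layerWeightR q d₁ d₂ α β r y : ℝ) : ℂ))
    (Function.mem_support.mpr (show (fun y : ℝ × ℝ ↦
      ((dyadicBump (y.1 / 2 ^ i.1) * dyadicBump (y.2 / 2 ^ i.2) : ℝ) : ℂ) *
        ((layerWeightR q d₁ d₂ α β r y : ℝ) : ℂ)) (t₁, t₂) ≠ 0 from h))
  exact ⟨hmem.1, hmem.2⟩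

/-- **The factorisation at integer points, box form**: for `k ∈ ℕ²` and `r ≥ 1`,
`Φ_i(k₁,k₂) · S(α·k₁, β·k₂; qr) = θ(k₁/2^{i₁})θ(k₂/2^{i₂}) · [w_q(d₁k₁,d₂k₂)·petKloostermanTerm q (αk₁)(βk₂) r]`.
[cite: KowalskiMichel2000, §2.4.2 p. 312 — derivation] -/
theorem boxWeight_mul_kloostermanSum [NeZero q] (hr : r ≠ 0) [NeZero (q * r)] (i k : ℕ × ℕ) :
    boxWeight q d₁ d₂ α β r i k.1 k.2 *
        kloostermanSum (q * r) ((α : ZMod (q * r)) * (k.1 : ZMod (q * r)))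
          ((β : ZMod (q * r)) * (k.2 : ZMod (q * r))) =
      ((dyadicBump ((k.1 : ℝ) / 2 ^ i.1) * dyadicBump ((k.2 : ℝ) / 2 ^ i.2) : ℝ) : ℂ) *
        ((afeWeight q (d₁ * k.1, d₂ * k.2) : ℂ) * petKloostermanTerm q (α * k.1) (β * k.2) r) := by
  rw [afeWeight_mul_petKloostermanTerm_eq q hr, boxWeight, layerWeightR, mul_assoc]

end BoxWeight

/-! ### The dual count: zero frequency absent, dual congruence, multiplicity ≤ 1 -/

section DualCount

variable {c : ℕ} [NeZero c]

/-- `N_c` is the cardinality that `OffDiag.sum_sum_kloostermanSum_mul_stdAddChar` produces: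
`Σ_{x₁,x₂} S(αx₁,βx₂;c)e_c(h₁x₁+h₂x₂) = c²·N_c(α,β;h₁,h₂)`. [folklore] -/
theorem sum_sum_kloostermanSum_mul_stdAddChar_eq_dualCount (α β h₁ h₂ : ZMod c) :
    ∑ x₁ : ZMod c, ∑ x₂ : ZMod c,
        kloostermanSum c (α * x₁) (β * x₂) * (ZMod.stdAddChar (h₁ * x₁ + h₂ * x₂) : ℂ) =
      (c : ℂ) ^ 2 * (dualCount c α β h₁ h₂ : ℂ) :=
  sum_sum_kloostermanSum_mul_stdAddChar α β h₁ h₂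

/-- **The zero frequency is absent**: `N_c(α,β;0,h₂) = 0` whenever `α ≢ 0 (mod c)` (no unit `u` has `αu = 0`).
[folklore] -/
theorem dualCount_zero_left {α : ZMod c} (hα : α ≠ 0) (β h₂ : ZMod c) : dualCount c α β 0 h₂ = 0 := by
  rw [dualCount, Finset.card_eq_zero]
  refine Finset.filter_false_of_mem fun u _ hu ↦ hα ?_
  have h1 := hu.1
  rw [add_zero] at h1
  simpa using congrArg (· * ((u⁻¹ : (ZMod c)ˣ) : ZMod c)) h1

/-- **Prime level**: for `q` prime, `1 ≤ a < q`, `r ≥ 1`: `N_{qr}(a,β;0,h₂) = 0` — the zero frequency of EVERY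
layer of `offDiag` is absent. [cite: KowalskiMichelVanderKam2000, Lemma 3.3 p. 9 — derivation] -/
theorem dualCount_primeLevel_zero_left {q a r : ℕ} [NeZero (q * r)] (hq : q.Prime) (ha : 1 ≤ a) (haq : a < q)
    (hr : 1 ≤ r) (β h₂ : ZMod (q * r)) : dualCount (q * r) (a : ZMod (q * r)) β 0 h₂ = 0 :=
  dualCount_zero_left (natCast_ne_zero_of_lt_prime hq ha haq hr) β h₂

/-- **Only the dual congruence survives**: `N_c(α,β;h₁,h₂) = 0` unless `h₁h₂ = αβ` in `ℤ/c`. [folklore] -/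
theorem dualCount_eq_zero_of_ne {α β h₁ h₂ : ZMod c} (hne : h₁ * h₂ ≠ α * β) : dualCount c α β h₁ h₂ = 0 := by
  rw [dualCount, dualUnits_eq_empty_of_ne hne, Finset.card_empty]

/-- Multiplicity at most one when `α` is a unit. [folklore] -/
theorem dualCount_le_one {α : ZMod c} (hα : IsUnit α) (β h₁ h₂ : ZMod c) : dualCount c α β h₁ h₂ ≤ 1 :=
  card_dualUnits_le_one hα β h₁ h₂

/-- Trivial bound `N_c ≤ #(ℤ/c)ˣ ≤ c`. [folklore] -/
theorem dualCount_le (α β h₁ h₂ : ZMod c) : dualCount c α β h₁ h₂ ≤ c := by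
  rw [dualCount]
  calc _ ≤ (univ : Finset (ZMod c)ˣ).card := Finset.card_filter_le _ _
    _ = Fintype.card (ZMod c)ˣ := Finset.card_univ
    _ ≤ Fintype.card (ZMod c) := Fintype.card_le_of_injective _ Units.val_injective
    _ = c := ZMod.card c

end DualCount

/-! ### The box identity -/

section Box

variable {q d₁ d₂ α β r : ℕ}

/-- The dual series of a box converges absolutely (Φ̂_i decays like a lattice majorant; `N ≤ c`). [folklore] -/
theorem summable_dual [NeZero q] (hd₁ : 1 ≤ d₁) (hd₂ : 1 ≤ d₂) (hα : 1 ≤ α) (hβ : 1 ≤ β)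
    [NeZero (q * r)] (i : ℕ × ℕ) :
    Summable (fun h : ℤ × ℤ ↦ fourier2 (boxWeight q d₁ d₂ α β r i) (h.1 / (q * r : ℕ)) (h.2 / (q * r : ℕ)) *
      (dualCount (q * r) (α : ZMod (q * r)) (β : ZMod (q * r)) (h.1 : ZMod (q * r)) (h.2 : ZMod (q * r)) : ℂ)) := by
  have hc : (0 : ℝ) < (q * r : ℕ) := by exact_mod_cast Nat.pos_of_ne_zero (NeZero.ne (q * r))
  have hF := (OffDiagPoissonTwisted.summable_fourier2_lattice_of_contDiff
    (contDiff_uncurry_boxWeight (q := q) (r := r) hd₁ hd₂ hα hβ i)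
    (hasCompactSupport_uncurry_boxWeight (q := q) (r := r) i) hc).norm.mul_right ((q * r : ℕ) : ℝ)
  refine Summable.of_norm_bounded hF fun h ↦ ?_
  rw [norm_mul, Complex.norm_natCast]
  exact mul_le_mul_of_nonneg_left (by exact_mod_cast dualCount_le _ _ _ _) (norm_nonneg _)

/-- **THE BOX IDENTITY (Poisson summation applied to one dyadic box of one Kloosterman layer).** For
`q, d₁, d₂, α, β, r ≥ 1` and a box `i = (i₁,i₂)`:
`Σ_{k ∈ ℕ²} θ(k₁/2^{i₁})θ(k₂/2^{i₂}) · w_q(d₁k₁,d₂k₂) · petKloostermanTerm q (αk₁)(βk₂) r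
   = Σ_{(h₁,h₂) ∈ ℤ²} Φ̂_i(h₁/(qr), h₂/(qr)) · N_{qr}(α,β;h₁,h₂)`.
GATE G2 §(a) row a5: «double Poisson (n₁,n₂) mod cq: Σ G S(…;cq) = Σ_{h₁h₂ ≡ A (cq)} Ĝ_c(h₁/cq, h₂/cq)».
[cite: KowalskiMichelVanderKam2000, (21)–(23) p. 12 and Lemma 3.3 p. 9 — derivation] -/
theorem tsum_box_eq_tsum_dual [NeZero q] (hd₁ : 1 ≤ d₁) (hd₂ : 1 ≤ d₂) (hα : 1 ≤ α) (hβ : 1 ≤ β)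
    (hr : r ≠ 0) [NeZero (q * r)] (i : ℕ × ℕ) :
    ∑' k : ℕ × ℕ, ((dyadicBump ((k.1 : ℝ) / 2 ^ i.1) * dyadicBump ((k.2 : ℝ) / 2 ^ i.2) : ℝ) : ℂ) *
        ((afeWeight q (d₁ * k.1, d₂ * k.2) : ℂ) * petKloostermanTerm q (α * k.1) (β * k.2) r) =
      ∑' h : ℤ × ℤ, fourier2 (boxWeight q d₁ d₂ α β r i) (h.1 / (q * r : ℕ)) (h.2 / (q * r : ℕ)) *
        (dualCount (q * r) (α : ZMod (q * r)) (β : ZMod (q * r)) (h.1 : ZMod (q * r)) (h.2 : ZMod (q * r)) : ℂ) := by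
  have hc0 : ((q * r : ℕ) : ℂ) ≠ 0 := by exact_mod_cast NeZero.ne (q * r)
  -- the summand is `Φ_i(k)·K(k)` with `K x₁ x₂ = S(αx₁, βx₂; qr)`
  have hsummand : ∀ k : ℕ × ℕ,
      ((dyadicBump ((k.1 : ℝ) / 2 ^ i.1) * dyadicBump ((k.2 : ℝ) / 2 ^ i.2) : ℝ) : ℂ) *
        ((afeWeight q (d₁ * k.1, d₂ * k.2) : ℂ) * petKloostermanTerm q (α * k.1) (β * k.2) r) =
      boxWeight q d₁ d₂ α β r i k.1 k.2 *
        kloostermanSum (q * r) ((α : ZMod (q * r)) * (k.1 : ZMod (q * r)))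
          ((β : ZMod (q * r)) * (k.2 : ZMod (q * r))) :=
    fun k ↦ (boxWeight_mul_kloostermanSum hr i k).symm
  rw [tsum_congr hsummand]
  -- Poisson (d1) in d2's shape
  rw [tsum_nat_prod_mul_stdAddChar_eq_of_contDiff (contDiff_uncurry_boxWeight hd₁ hd₂ hα hβ i)
    (hasCompactSupport_uncurry_boxWeight i) (boxWeight_ne_zero_pos i)
    (fun x₁ x₂ ↦ kloostermanSum (q * r) ((α : ZMod (q * r)) * x₁) ((β : ZMod (q * r)) * x₂))]
  -- evaluate the complete sums (d2) and cancel `c⁻² · c²`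
  simp_rw [sum_sum_kloostermanSum_mul_stdAddChar_eq_dualCount]
  rw [← tsum_mul_left]
  refine tsum_congr fun h ↦ ?_
  field_simp

end Box

/-! ### The layer identity -/

section Layer

variable {q d₁ d₂ α β r : ℕ}

/-- **THE LAYER IDENTITY.** For `q, d₁, d₂, α, β, r ≥ 1`, if the layer summand
`k ↦ w_q(d₁k₁,d₂k₂)·petKloostermanTerm q (αk₁)(βk₂) r` is absolutely summable on `ℕ²` (Weil + the decay of `W`;
`PeterssonSplit.OffDiagLayers`), then
`Σ_{k ∈ ℕ²} w_q(d₁k₁,d₂k₂)·petKloostermanTerm q (αk₁)(βk₂) r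
   = Σ_{i ∈ ℕ²} Σ_{(h₁,h₂) ∈ ℤ²} Φ̂_i(h₁/(qr), h₂/(qr)) · N_{qr}(α,β;h₁,h₂)`,
the outer box series absolutely convergent. [cite: KowalskiMichelVanderKam2000, (21)–(23) p. 12 and Lemma 3.3 p. 9 — derivation] -/
theorem tsum_layer_eq_tsum_boxes_dual [NeZero q] (hd₁ : 1 ≤ d₁) (hd₂ : 1 ≤ d₂) (hα : 1 ≤ α) (hβ : 1 ≤ β)
    (hr : r ≠ 0) [NeZero (q * r)]
    (hsum : Summable (fun k : ℕ × ℕ ↦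
      (afeWeight q (d₁ * k.1, d₂ * k.2) : ℂ) * petKloostermanTerm q (α * k.1) (β * k.2) r)) :
    ∑' k : ℕ × ℕ, (afeWeight q (d₁ * k.1, d₂ * k.2) : ℂ) * petKloostermanTerm q (α * k.1) (β * k.2) r =
      ∑' i : ℕ × ℕ, ∑' h : ℤ × ℤ,
        fourier2 (boxWeight q d₁ d₂ α β r i) (h.1 / (q * r : ℕ)) (h.2 / (q * r : ℕ)) *
          (dualCount (q * r) (α : ZMod (q * r)) (β : ZMod (q * r)) (h.1 : ZMod (q * r)) (h.2 : ZMod (q * r)) : ℂ) := by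
  rw [tsum_eq_tsum_dyadicBoxes hsum (fun k hk ↦ by
    rw [afeWeight_dilated_eq_zero_of_axis q d₁ d₂ hk, Complex.ofReal_zero, zero_mul])]
  exact tsum_congr fun i ↦ tsum_box_eq_tsum_dual hd₁ hd₂ hα hβ hr i

/-- The box series of the layer identity converges absolutely (whenever the layer summand does). [folklore] -/
theorem summable_boxes_dual [NeZero q] (hd₁ : 1 ≤ d₁) (hd₂ : 1 ≤ d₂) (hα : 1 ≤ α) (hβ : 1 ≤ β)
    (hr : r ≠ 0) [NeZero (q * r)]
    (hsum : Summable (fun k : ℕ × ℕ ↦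
      (afeWeight q (d₁ * k.1, d₂ * k.2) : ℂ) * petKloostermanTerm q (α * k.1) (β * k.2) r)) :
    Summable (fun i : ℕ × ℕ ↦ ∑' h : ℤ × ℤ,
      fourier2 (boxWeight q d₁ d₂ α β r i) (h.1 / (q * r : ℕ)) (h.2 / (q * r : ℕ)) *
        (dualCount (q * r) (α : ZMod (q * r)) (β : ZMod (q * r)) (h.1 : ZMod (q * r)) (h.2 : ZMod (q * r)) : ℂ)) := by
  refine (summable_dyadicBoxes hsum).congr fun i ↦ ?_
  exact tsum_box_eq_tsum_dual hd₁ hd₂ hα hβ hr i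

/-- **Zero frequency absent, in the layer identity**: at prime level (`q` prime, `1 ≤ α < q`, `r ≥ 1`) the
`h = (0, h₂)` and `h = (h₁, 0)`-type terms with `h₁ = 0` contribute nothing: `Φ̂_i(0, h₂/(qr))·N(0,h₂) = 0`.
[cite: KowalskiMichelVanderKam2000, Lemma 3.3 p. 9 — derivation] -/
theorem dual_term_zero_left_eq_zero {q a r : ℕ} [NeZero (q * r)] (hq : q.Prime) (ha : 1 ≤ a) (haq : a < q)
    (hr : 1 ≤ r) (Φ : ℝ → ℝ → ℂ) (β : ZMod (q * r)) (h₂ : ℤ) (ξ₂ : ℝ) :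
    fourier2 Φ 0 ξ₂ * (dualCount (q * r) (a : ZMod (q * r)) β ((0 : ℤ) : ZMod (q * r)) (h₂ : ZMod (q * r)) : ℂ)
      = 0 := by
  rw [Int.cast_zero, dualCount_primeLevel_zero_left hq ha haq hr, Nat.cast_zero, mul_zero]

end Layer

end Summit.Parity.GeneralizedHardyLittlewood.Theorems.BeyondDiagonalBeatsQuarter.OffDiag
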